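import Summits.CriticalPhenomena.SAWScalingLimit.Theses.SAWTotalPositivity
import Summits.CriticalPhenomena.SAWScalingLimit.Theorems.SAWTotalPositivityTPToTraversalBoundShellTight

/-!
# Line `radial-portal-transfer` — skeleton for crux `TPToTraversalBound` (stmt-CriticalPhenomena-10687), rev 5

Lead c1's skeleton (rev 5, 2026-08-16), KEPT UNCHANGED by leads c2, c3 and c4 (2026-08-16T17Z, this header note only):
re-checked (rc 0, 1 sorry in the registered stub, `TPToTraversalBound_of` concludes the crux by name) and re-registered;
the leads' verdicts are in `PICKED.md` / `NOTES.md` / `Lines/*.dead.md` of the crux directory (the single stub is the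
crux itself, kernel-checked; all lines dead).  Rev 5 = rev 4 RESHAPED to its single honest residual.

Crux (route `SAWTotalPositivity`, rank 3):
`TPToTraversalBound := BoundaryTP2 → CriticalBubbleBound → SAWTraversalBound` (`Iff.rfl`, Disproof §1), i.e.
circular TP₂ of the critical SAW boundary kernel + the finite bubble should give the Aizenman–Burchard hypothesis
(H1) for the chordal critical square-lattice SAW.

What rev 4 (lead 0, `Lines/radial_portal_transfer.lean`, 4 sorries) had: the line's bookkeeping LANDED (RadialDefs
p77171; Chain p79903 with ChainIter p76503, ChainPieces p77690, ChainTransfer p78115; CleanContractionAux p87884;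
BoundaryShellsAux p87723; TopHeavinessAux p88026, TopHeavinessTransfer p93295, TopHeavinessTail p98368;
DecorationRemovalAux p99220) and four registered residual stubs: `stub_cleanContractionCore : CleanContractionCore`,
`stub_decorationRemovalCore : BoundaryTP2 → CriticalBubbleBound → CleanContractionCore → HeavinessContractionCore`
(the radial chain's G2 core), `stub_deepTraversalTail : DeepTraversalTail 20 100` (top state in AB currency) and
`stub_boundaryShellTight : BoundaryShellTight` (frontier-centred shells, per-shell tightness).

What this seat PROVED (tree files of namespace `Summit.CriticalPhenomena.SAWScalingLimit.Theorems.TPToTraversalBound.Radial`):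
* `…TPToTraversalBoundShellTight` — `ShellTight` := per-shell, rate-free, uniform-in-mesh tightness of the traversal
  number of the chordal critical SAW (for every Dobrushin domain, endpoint approximation, fixed shell `D(x; ρ, R)`,
  `0 < ρ < R ≤ 1`, and `ε > 0` some `k, δ₀` with `P_δ(k separate traversals) ≤ ε` for `δ ≤ δ₀`), and the
  EQUIVALENCES `shellTight_iff_traversalBound : ShellTight ↔ SAWTraversalBound`,
  `tpToTraversalBound_iff_shellTight : TPToTraversalBound ↔ (BoundaryTP2 → CriticalBubbleBound → ShellTight)`
  (capacity cutoff at coarse meshes one way, net localization on the middle circle + union bound the other way; no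
  TP₂, no bubble, no Jordan property used);
* `…TPToTraversalBoundShellTightOfRadial` — `interiorShellBound_of_deepTraversalTail : DeepTraversalTail 20 100 →
  InteriorShellBound` (the contraction stubs 1′, 2′ and the chain were REDUNDANT: a traversal of an interior shell with
  `R > 100ρ` traverses its deep sub-shell `D(x; R/100, R/5)`), the rev-4 shell reduction
  `traversalBound_of_shellBounds` landed, and `shellTight_of_deepTraversalTail_of_boundaryShellTight :
  DeepTraversalTail 20 100 → BoundaryShellTight → ShellTight` (rev 4's stubs 3′ + 5′ imply rev 5's stub: the reshape
  is a weakening of the stub burden with the same conclusion).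

So the skeleton is now ONE registered stub, `stub_shellTight : BoundaryTP2 → CriticalBubbleBound → ShellTight`, and
the composition `TPToTraversalBound_of := tpToTraversalBound_of_shellTight stub_shellTight` concludes the crux BY
NAME.  By `tpToTraversalBound_iff_shellTight` the stub is EQUIVALENT to the crux: the line has no content left beyond
the crux itself in rate-free form — per-shell sub-sequential tightness of the critical `ℤ²` SAW, a
Kemppainen–Smirnov Condition-G2-strength statement (KS17 list SAW as unverified; DKY14 Problem 10 open; Disproof F4:
TP₂ + B + planarity are consistent with its negation for the toy kernel `Z ≡ 1`, so the stub's two hypotheses cannot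
be its only input).  Disproof.lean (v9) obligations: F1 (no `_false_without_` theorem exists), F2/F3 (the stub keeps
`k, δ₀` per shell and per `ε` — immune to the all-δ / constant-threshold / uniform near-misses), F6/F7 (no pairing
inequality, no rim push asserted).
-/

noncomputable section

open Literature.Probability.LatticeModels
open Literature.Probability.RandomPlanarGeometry
open Literature.Probability.RandomPlanarGeometry.SAW
open Summit.CriticalPhenomena.SAWScalingLimit.Theses.SAWTotalPositivity
open Summit.CriticalPhenomena.SAWScalingLimit.Theorems.TPToTraversalBound.Radial

namespace Summit.CriticalPhenomena.SAWScalingLimit.Cruxes.TPToTraversalBound.RadialPortalTransfer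

/-! ## The registered stub (`sorry` only here) -/

/-- STUB (the single residual of the line; crux-equivalent by `tpToTraversalBound_iff_shellTight`): circular TP₂ of
the critical SAW boundary kernel and the finite bubble imply PER-SHELL TIGHTNESS OF THE TRAVERSAL NUMBER — for every
Dobrushin domain `D`, endpoint approximation `(a_δ, b_δ)`, fixed shell `D(x; ρ, R)` with `0 < ρ < R ≤ 1` and `ε > 0`
there are `k, δ₀` with `SAW.law D δ a_δ b_δ {k separate traversals of D(x; ρ, R)} ≤ ε` for all `δ ∈ (0, δ₀]`
(`ShellTight`, tree `…TPToTraversalBoundShellTight`).  OPEN (KS Condition G2 / an RSW upper bound for the critical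
square-lattice SAW); rev 4's `DeepTraversalTail 20 100 ∧ BoundaryShellTight` implies it
(`shellTight_of_deepTraversalTail_of_boundaryShellTight`). -/
theorem stub_shellTight : BoundaryTP2 → CriticalBubbleBound → ShellTight := by
  sorry

/-! ## Composition (sorry-free) -/

/-- **`TPToTraversalBound` from the stub.**  The crux is `TP₂ → B → (H1)` (`Iff.rfl`) and (H1) is per-shell
tightness (`shellTight_iff_traversalBound`); `tpToTraversalBound_of_shellTight` is the landed composition. -/
theorem TPToTraversalBound_of : TPToTraversalBound :=
  tpToTraversalBound_of_shellTight stub_shellTight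

end Summit.CriticalPhenomena.SAWScalingLimit.Cruxes.TPToTraversalBound.RadialPortalTransfer

end
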